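import Literature.NumberTheory.Transcendental.RoySmallValueStep4GlueB
import Literature.NumberTheory.Transcendental.RoySmallValueStep2Distances
import Literature.NumberTheory.Transcendental.RoySmallValueOrbitLiouville
import Literature.NumberTheory.Transcendental.RoySmallValueOrbitSelection
import Literature.NumberTheory.Transcendental.RoySmallValueDistance
import HarnessLib

/-!
# Roy's small value estimate for `𝔾ₐ × 𝔾ₘ` — §7 Step 4 on the selected orbit, and Steps 4–5 combined

Topic `Literature/NumberTheory/Transcendental`. Part of the formalisation of the proof of Roy 2013,
Theorem 1.1 (named fact `roy2013_thm_1_1`, `RoySmallValueEstimates.lean`), seat B. Source: D. Roy,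
*A small value estimate for `𝔾ₐ × 𝔾ₘ`*, Mathematika 59 (2013) 333–363 = arXiv:1301.0663, §7,
Step 4 (p. 19 of the arXiv text):

> [...] there exists an integer `i₀` with `0 ≤ i₀ < 2⌊(D*)^τ⌋` such that `Z` is not contained in
> the curve of `ℙ²` defined by the polynomial `P* := 𝒟^{i₀}P̃_{D*}`. For `D` large enough, we also
> have `P* ∈ 𝒞_{D*} ∩ ℤ[X]`. Then, Proposition 2.4 gives `0 ≤ 7 log(3) D* deg(Z) + D* h(Z) + ∑ log|P*(α)|`.
> [...] `max_α log|P*(α)| ≤ D* log(3) + log‖P*‖ ≤ 4(D*)^β` [...] Proposition 4.5 provides [...]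
> for any subset `𝒮` of `𝒰`, `∑_{α∈𝒮} max{T* log dist(α,(1:γ)), log dist(α,A_γ)} ≥ −8(D*)^β deg(Z) − D* h(Z)`.

For the orbit `O = orb i₀` of `Z : ZeroConfigK K ι` and an integer form `R ∈ ℤ[X]_{D_s}` whose
complexification lies in Roy's body `royBody D_s ξ η Y U T_s` and which does not vanish at some
point of `O`, we feed `step4_sum_max_ge'` (`RoySmallValueStep4GlueB`) with: Liouville on the orbit
(`orbit_liouville_log'`), the crude bound `log|R(u_j)| ≤ D_s log 3 + Y` (`|R(u)| ≤ 𝓛(R) ≤ 3^{D_s}‖R‖`),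
and the parallel seat's `prop_4_2` (Roy's Prop. 4.5) at the sup-normalised points of `𝒮 ⊆ 𝒰 ∩ O`,
and obtain (`ZeroConfigK.step4_orbit`), under the largeness condition
`log 2 + 2c₂² − U < −(D_s h(O) + #O (D_s log 3 + Y))`,

  `∑_{j∈𝒮} max{T_s log d₁(u_j), b_j} ≥ −( D_s h(O) + #O (D_s log 3 + Y) + #𝒮 log(4 · 3^{D_s} e^Y c₄^{D_s}) )`

for any honest second coordinates `b_j ≥ log d₂(u_j)` (when `d₂ > 0`).

Step 5 (p. 19) then partitions `𝒰` ("Combining these three inequalities, we obtain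
`−(D^δ/25)(D^β deg(Z) + D h(Z)) ≥ −(T/T* + 1)(8(D*)^β deg(Z) + D* h(Z))`"): given the Step-2
inequality on the orbit in the form `∑_{j∈𝒰∩O} max{T log d₁(u_j), log⁎ d₂(u_j)} ≤ −Λ₂` (the output of
`LevelPkg.step2_level`), `ZeroConfigK.step45_combined` chains `step4_orbit` with the partition lemma
`le_ratio_add_one_mul` (`RoySmallValueStepsGlue`) into

  `Λ₂ ≤ (T/T_s + 1) · ( D_s h(O) + #O (D_s log 3 + Y_s) + #O log(4·3^{D_s} e^{Y_s} c₄^{D_s}) )`.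

Everything is proved; no definitions, no named facts.

## References

* [Roy2013] D. Roy, *A small value estimate for 𝔾ₐ × 𝔾ₘ*, Mathematika 59 (2013), 333–363
  (arXiv:1301.0663), §7, Steps 4 and 5; Propositions 2.4 and 4.5.
-/

noncomputable section

open MvPolynomial Finset Height

namespace Literature.NumberTheory.Transcendental

namespace Roy2013

open Nesterenko

/-- `|P(w)| ≤ 𝓛(P)` for `‖wᵢ‖ ≤ 1`. [folklore] -/
theorem norm_eval_le_l1Norm' (P : CX) {w : Fin 3 → ℂ} (hw : ∀ i, ‖w i‖ ≤ 1) :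
    ‖eval w P‖ ≤ l1Norm P := by
  classical
  rw [eval_eq, l1Norm]
  refine (norm_sum_le _ _).trans (Finset.sum_le_sum fun d _ => ?_)
  rw [norm_mul]
  refine mul_le_of_le_one_right (norm_nonneg _) ?_
  rw [norm_prod]
  exact Finset.prod_le_one (fun i _ => norm_nonneg _) fun i _ => by
    rw [norm_pow]; exact pow_le_one₀ (norm_nonneg _) (hw i)

/-- **The crude bound** `|R(u)| ≤ 3^D e^Y` for `R ∈ 𝒞_D` and sup-normalised `u`.
[cite: Roy2013, §7, Step 4 ("`max log|P*(α)| ≤ D* log(3) + log‖P*‖`")] -/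
theorem norm_eval_le_of_mem_royBody {D : ℕ} {ξ η : ℂ} {Y U : ℝ} {T : ℕ} {R : CX}
    (hR : R ∈ royBody D ξ η Y U T) {w : Fin 3 → ℂ} (hw : ∀ i, ‖w i‖ ≤ 1) :
    ‖eval w R‖ ≤ 3 ^ D * Real.exp Y := by
  calc ‖eval w R‖ ≤ l1Norm R := norm_eval_le_l1Norm' R hw
    _ ≤ R.support.card * maxNorm R := l1Norm_le_card_mul_maxNorm R
    _ ≤ 3 ^ D * Real.exp Y := by
        refine mul_le_mul ?_ hR.2.1 (maxNorm_nonneg _) (by positivity)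
        exact_mod_cast card_support_le_pow_of_isHomogeneous hR.1

namespace ZeroConfigK

variable {K : IntermediateField ℚ ℂ} {ι : Type*} [Fintype ι] [DecidableEq ι] (Z : ZeroConfigK K ι)
  [Normal ℚ K] [NumberField K]

/-- **Roy 2013, §7, Step 4 on the orbit `O = orb i₀`**: see the module docstring.
[cite: Roy2013, §7, Step 4] -/
theorem step4_orbit (i₀ : ι) {ξ η : ℂ} {Ds Ts : ℕ} {Y U : ℝ} {R : MvPolynomial (Fin 3) ℤ}
    (hR : R.IsHomogeneous Ds) (hRmem : map (Int.castRingHom ℂ) R ∈ royBody Ds ξ η Y U Ts)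
    (hRne : ∃ j ∈ Z.orb i₀, aeval (Z.α j) (map (Int.castRingHom ℂ) R) ≠ 0)
    (S : Finset ι) (hSO : S ⊆ Z.orb i₀)
    (hSU : ∀ j ∈ S, pdist ξ η (supNormalise (Z.α j)) ≤ (2 * roy_c2 ξ η)⁻¹)
    (hSd : ∀ j ∈ S, 0 < pdist ξ η (supNormalise (Z.α j))) (b : ι → ℝ)
    (hb : ∀ j ∈ S, 0 < adist ξ η (supNormalise (Z.α j)) → Real.log (adist ξ η (supNormalise (Z.α j))) ≤ b j)
    (hY : 0 ≤ Ds * Real.log 3 + Y)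
    (hbig : Real.log 2 + 2 * roy_c2 ξ η ^ 2 - U <
      -(Ds * ((∑ j ∈ Z.orb i₀, logHeight (Z.rep j)) / Module.finrank ℚ K) +
        (Z.orb i₀).card * (Ds * Real.log 3 + Y))) :
    -(Ds * ((∑ j ∈ Z.orb i₀, logHeight (Z.rep j)) / Module.finrank ℚ K) +
        (Z.orb i₀).card * (Ds * Real.log 3 + Y) +
        S.card * Real.log (4 * (3 ^ Ds * Real.exp Y * roy_c4 ξ η ^ Ds))) ≤
      ∑ j ∈ S, max (Ts * Real.log (pdist ξ η (supNormalise (Z.α j)))) (b j) := by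
  classical
  -- `R` does not vanish at any point of the orbit
  obtain ⟨j₁, hj₁, hne₁⟩ := hRne
  have hval : ∀ j, aeval (Z.α j) (map (Int.castRingHom ℂ) R) = aeval (Z.α j) R := fun j => by
    rw [← algebraMap_int_eq, aeval_map_algebraMap]
  have hrep : ∀ j, aeval (Z.rep j) R ≠ 0 ↔ aeval (Z.α j) (map (Int.castRingHom ℂ) R) ≠ 0 := by
    intro j
    rw [hval, ← Z.coe_aeval_rep_int j R]
    exact ⟨fun h h0 => h (by exact_mod_cast h0), fun h h0 => h (by rw [h0]; rfl)⟩
  have hi₀ : aeval (Z.rep i₀) R ≠ 0 := by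
    have hmem : i₀ ∈ Z.orb j₁ := by rw [Z.orb_eq_of_mem hj₁]; exact Z.self_mem_orb i₀
    exact Z.aeval_rep_ne_zero_of_mem_orb hmem ((hrep j₁).mpr hne₁)
  have hall : ∀ j ∈ Z.orb i₀, aeval (Z.α j) (map (Int.castRingHom ℂ) R) ≠ 0 := fun j hj =>
    (hrep j).mp (Z.aeval_rep_ne_zero_of_mem_orb hj hi₀)
  -- the values `y_j = |R(u_j)| = |R(α_j)|/‖α_j‖^{Ds}`
  obtain ⟨y, hy⟩ : ∃ y : ι → ℝ, y = fun j => ‖eval (supNormalise (Z.α j)) (map (Int.castRingHom ℂ) R)‖ :=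
    ⟨_, rfl⟩
  have hyeq : ∀ j, y j = ‖aeval (Z.α j) R‖ / ‖Z.α j‖ ^ Ds := fun j => by
    rw [hy]; simp only
    rw [norm_eval_supNormalise hRmem.1, show (eval (Z.α j) (map (Int.castRingHom ℂ) R) : ℂ) =
      aeval (Z.α j) (map (Int.castRingHom ℂ) R) from rfl, hval]
  have hypos : ∀ j ∈ Z.orb i₀, 0 < y j := fun j hj => by
    rw [hyeq]
    exact div_pos (norm_pos_iff.mpr (by rw [← hval]; exact hall j hj))
      (pow_pos (norm_pos_iff.mpr (Z.α_ne_zero j)) _)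
  -- Liouville on the orbit
  have hL0 := Z.orbit_liouville_log' i₀ hR hi₀
  have hL : 0 ≤ Ds * ((∑ j ∈ Z.orb i₀, logHeight (Z.rep j)) / Module.finrank ℚ K) +
      ∑ j ∈ Z.orb i₀, Real.log (y j) := by
    simp only [hyeq]; exact hL0
  -- the crude bound
  have hsup1 : ∀ j, ∀ i, ‖supNormalise (Z.α j) i‖ ≤ 1 := fun j i =>
    supNormalise_le_one (Z.α_ne_zero j) i
  have hC : ∀ j ∈ Z.orb i₀, Real.log (y j) ≤ Ds * Real.log 3 + Y := by
    intro j hj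
    have h1 : y j ≤ 3 ^ Ds * Real.exp Y := by rw [hy]; exact norm_eval_le_of_mem_royBody hRmem (hsup1 j)
    have h2 := Real.log_le_log (hypos j hj) h1
    rwa [Real.log_mul (by positivity) (Real.exp_pos Y).ne', Real.log_pow, Real.log_exp] at h2
  -- Prop. 4.5 at the points of `S`
  have hvalS : ∀ j ∈ S, y j ≤ Real.exp (2 * roy_c2 ξ η ^ 2) * Real.exp (-U) +
      (3 ^ Ds * Real.exp Y * roy_c4 ξ η ^ Ds) *
        (pdist ξ η (supNormalise (Z.α j)) ^ Ts + adist ξ η (supNormalise (Z.α j))) := by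
    intro j hj
    have hu1 := exists_one_le_supNormalise (Z.α_ne_zero j)
    have hu0 : (2 * roy_c2 ξ η)⁻¹ ≤ ‖supNormalise (Z.α j) 0‖ := lemma_4_1 hu1 (hSU j hj)
    have h := prop_4_2 (T := Ts) hRmem.1 (hsup1 j) hu0 (hSU j hj) (Real.exp_pos (-U)).le
      (fun n hn => hRmem.2.2 n hn)
    rw [hy]
    refine h.trans (add_le_add le_rfl (mul_le_mul_of_nonneg_right ?_ ?_))
    · calc l1Norm (map (Int.castRingHom ℂ) R) * roy_c4 ξ η ^ Ds
          ≤ (3 ^ Ds * Real.exp Y) * roy_c4 ξ η ^ Ds := by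
            refine mul_le_mul_of_nonneg_right ?_ (pow_nonneg (roy_c4_pos ξ η).le _)
            calc l1Norm (map (Int.castRingHom ℂ) R) ≤ _ := l1Norm_le_card_mul_maxNorm _
              _ ≤ 3 ^ Ds * Real.exp Y := by
                refine mul_le_mul ?_ hRmem.2.1 (maxNorm_nonneg _) (by positivity)
                exact_mod_cast card_support_le_pow_of_isHomogeneous hRmem.1
      _ = 3 ^ Ds * Real.exp Y * roy_c4 ξ η ^ Ds := by ring
    · exact add_nonneg (pow_nonneg (pdist_nonneg _ _ _) _) (adist_nonneg _ _ _)
  -- apply the glue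
  have hM : 0 < 3 ^ Ds * Real.exp Y * roy_c4 ξ η ^ Ds := by
    have := roy_c4_pos ξ η; positivity
  have hglue := step4_sum_max_ge' hSO y (fun j => pdist ξ η (supNormalise (Z.α j)))
    (fun j => adist ξ η (supNormalise (Z.α j))) b Ts hypos hL hC hY
    (mul_pos (Real.exp_pos _) (Real.exp_pos _)) hM hSd (fun j _ => adist_nonneg _ _ _) hb hvalS
    (by
      have : Real.log (2 * (Real.exp (2 * roy_c2 ξ η ^ 2) * Real.exp (-U))) =
          Real.log 2 + 2 * roy_c2 ξ η ^ 2 - U := by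
        rw [Real.log_mul two_ne_zero (mul_pos (Real.exp_pos _) (Real.exp_pos _)).ne',
          Real.log_mul (Real.exp_pos _).ne' (Real.exp_pos _).ne', Real.log_exp, Real.log_exp]
        ring
      rw [this]; exact hbig)
  exact hglue

/-- **Roy 2013, §7, Steps 4–5 combined on the orbit** (see the module docstring, second display):
Step 4 (`step4_orbit`) for every `𝒮 ⊆ 𝒰 ∩ O`, chained with the partition lemma
`le_ratio_add_one_mul` of Step 5. [cite: Roy2013, §7, Steps 4–5] -/
theorem step45_combined (i₀ : ι) {ξ η : ℂ} {T Ds Ts : ℕ} {Ys Us Λ₂ : ℝ}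
    {R : MvPolynomial (Fin 3) ℤ} (hR : R.IsHomogeneous Ds)
    (hRmem : map (Int.castRingHom ℂ) R ∈ royBody Ds ξ η Ys Us Ts)
    (hRne : ∃ j ∈ Z.orb i₀, aeval (Z.α j) (map (Int.castRingHom ℂ) R) ≠ 0)
    (hTs : 0 < Ts) (hYs : 0 ≤ Ds * Real.log 3 + Ys)
    (hd₁ : ∀ j ∈ Z.orb i₀, 0 < pdist ξ η (supNormalise (Z.α j)))
    (hbig : Real.log 2 + 2 * roy_c2 ξ η ^ 2 - Us <
      -(Ds * ((∑ j ∈ Z.orb i₀, logHeight (Z.rep j)) / Module.finrank ℚ K) +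
        (Z.orb i₀).card * (Ds * Real.log 3 + Ys)))
    (h2 : ∑ j ∈ (Z.orb i₀).filter (fun j => pdist ξ η (supNormalise (Z.α j)) ≤ (2 * roy_c2 ξ η)⁻¹),
        max (T * Real.log (pdist ξ η (supNormalise (Z.α j))))
          (if 0 < adist ξ η (supNormalise (Z.α j)) then Real.log (adist ξ η (supNormalise (Z.α j)))
            else T * Real.log (pdist ξ η (supNormalise (Z.α j)))) ≤ -Λ₂) :
    Λ₂ ≤ ((T : ℝ) / Ts + 1) *
      (Ds * ((∑ j ∈ Z.orb i₀, logHeight (Z.rep j)) / Module.finrank ℚ K) +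
        (Z.orb i₀).card * (Ds * Real.log 3 + Ys) +
        (Z.orb i₀).card * Real.log (4 * (3 ^ Ds * Real.exp Ys * roy_c4 ξ η ^ Ds))) := by
  classical
  obtain ⟨U, hU⟩ : ∃ U : Finset ι,
      U = (Z.orb i₀).filter (fun j => pdist ξ η (supNormalise (Z.α j)) ≤ (2 * roy_c2 ξ η)⁻¹) := ⟨_, rfl⟩
  rw [← hU] at h2
  obtain ⟨b, hb⟩ : ∃ b : ι → ℝ, b = fun j =>
      if 0 < adist ξ η (supNormalise (Z.α j)) then Real.log (adist ξ η (supNormalise (Z.α j)))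
      else T * Real.log (pdist ξ η (supNormalise (Z.α j))) := ⟨_, rfl⟩
  have hbj : ∀ j, (if 0 < adist ξ η (supNormalise (Z.α j)) then Real.log (adist ξ η (supNormalise (Z.α j)))
      else T * Real.log (pdist ξ η (supNormalise (Z.α j)))) = b j := fun j => by rw [hb]
  simp only [hbj] at h2
  -- the log of the Step-4 constant is non-negative
  have hc4 := roy_c4_pos ξ η
  have hlog4 : 0 ≤ Real.log (4 * (3 ^ Ds * Real.exp Ys * roy_c4 ξ η ^ Ds)) := by
    refine Real.log_nonneg ?_
    have h1 : (1 : ℝ) ≤ 3 ^ Ds * Real.exp Ys * roy_c4 ξ η ^ Ds := by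
      have hY1 : Real.exp (-(Ds * Real.log 3)) ≤ Real.exp Ys := Real.exp_le_exp.mpr (by linarith)
      have h3 : Real.exp (-(Ds * Real.log 3)) * 3 ^ Ds = 1 := by
        rw [← Real.rpow_natCast, ← Real.exp_log (by norm_num : (0 : ℝ) < 3), ← Real.exp_mul,
          Real.log_exp, ← Real.exp_add]; simp [mul_comm]
      have hc4D : (1 : ℝ) ≤ roy_c4 ξ η ^ Ds := one_le_pow₀ (by
        have := one_le_roy_c2 ξ η
        rw [roy_c4, roy_A]; nlinarith [Real.add_one_le_exp (2 * roy_c2 ξ η ^ 2), Real.exp_pos (roy_c2 ξ η)])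
      calc (1 : ℝ) = Real.exp (-(Ds * Real.log 3)) * 3 ^ Ds * 1 := by rw [h3, one_mul]
        _ ≤ Real.exp Ys * 3 ^ Ds * roy_c4 ξ η ^ Ds := by gcongr
        _ = 3 ^ Ds * Real.exp Ys * roy_c4 ξ η ^ Ds := by ring
    linarith
  -- Step 4 for every `S ⊆ U`
  have h4 : ∀ S ⊆ U, -(Ds * ((∑ j ∈ Z.orb i₀, logHeight (Z.rep j)) / Module.finrank ℚ K) +
      (Z.orb i₀).card * (Ds * Real.log 3 + Ys) +
      (Z.orb i₀).card * Real.log (4 * (3 ^ Ds * Real.exp Ys * roy_c4 ξ η ^ Ds))) ≤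
        ∑ j ∈ S, max (Ts * Real.log (pdist ξ η (supNormalise (Z.α j)))) (b j) := by
    intro S hS
    have hSO : S ⊆ Z.orb i₀ := hS.trans (by rw [hU]; exact filter_subset _ _)
    have hSU : ∀ j ∈ S, pdist ξ η (supNormalise (Z.α j)) ≤ (2 * roy_c2 ξ η)⁻¹ := fun j hj => by
      have := hS hj; rw [hU] at this; exact (mem_filter.mp this).2
    have hstep := Z.step4_orbit i₀ hR hRmem hRne S hSO hSU (fun j hj => hd₁ j (hSO hj)) b
      (fun j _ hpos => by rw [hb]; simp only [hpos, if_true]; exact le_rfl) hYs hbig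
    refine le_trans ?_ hstep
    have hcardS : (S.card : ℝ) ≤ (Z.orb i₀).card := by exact_mod_cast card_le_card hSO
    nlinarith
  -- Step 5: the partition
  exact le_ratio_add_one_mul U (fun j => Real.log (pdist ξ η (supNormalise (Z.α j)))) b
    (Nat.cast_nonneg T) (by exact_mod_cast hTs) h2 h4

end ZeroConfigK

end Roy2013

end Literature.NumberTheory.Transcendental
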